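import Summits.CriticalPhenomena.PercolationContinuityZ3.Theorems.PercNearOneGluingNoHeavyLowerTailKNGoodSeriesTools
import Summits.CriticalPhenomena.PercolationContinuityZ3.Theorems.PercNearOneGluingNoHeavyLowerTailCILTwoSteinerTools
import HarnessLib

/-!
# The series step for Kozma–Nitzan GOODNESS — tools II: the observer glued into one or two neighbours
# (`NoHeavyLowerTail` cell, stmt-CriticalPhenomena-4575; prover `prim-hp-2`, deletion–contraction line, gen 3)

Support file (`--supports stmt-CriticalPhenomena-4575`).  No definitions, no named facts, no sorries.  Notation as in tools I
(`agood(u, v; a)` written out in full; `w⁰ = pinW w {pairs at o} ∅` = `G − o`; `e = s(o,x)`, `f = s(o,y)`, `g = s(x,y)`).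

* `KNGoodSeries.sum_nullSets_reindex_erase` — bookkeeping: a sum over the relay-free sets `W ∋ o` of terms depending on `W ∖ {o}`
  equals the corresponding sum over the relay-free sets not containing `o`.
* `KNGoodSeries.agood_wzero_glue_one` — **corner (1,0)**: `agood(w⁰[e↦1], o; a) = agood(w⁰, x; a)` (the observer glued to `x` IS the
  observer `x` of `G − o`: its cluster is `{o} ∪ C(x)`, the minima `min P(· ↔ b off W)` do not see the isolated `o`).
* `KNGoodSeries.agood_wzero_glue_two` — **corner (1,1)**: `agood(w⁰[e↦1][f↦1], o; a) = agood(w⁰[g↦1], x; a)` (glued to both `x` and `y`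
  = the observer `x` of `(G − o) + xy`).
-/

noncomputable section

namespace Summit.CriticalPhenomena.PercolationContinuityZ3.Theorems

open MeasureTheory Set Literature.Probability.LatticeModels Literature.Probability.Percolation
open scoped Classical BigOperators

variable {n : ℕ}

namespace KNGoodSeries

open ChampionStability KNGoodAux KNGoodHair RelayNbhd CILTwoSteiner

/-- Reindexing a sum over the relay-free sets containing `o ∉ A` by `W ↦ W ∖ {o}`. [folklore] -/
theorem sum_nullSets_reindex_erase (A : Finset (Fin n)) (o : Fin n) (ho : o ∉ A) (F G : Finset (Fin n) → ℝ)
    (hF : ∀ W ∈ nullSets A, o ∉ W → F W = 0) (hG : ∀ W ∈ nullSets A, o ∈ W → G W = 0)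
    (hFG : ∀ W ∈ nullSets A, o ∈ W → F W = G (W.erase o)) :
    ∑ W ∈ nullSets A, F W = ∑ W ∈ nullSets A, G W := by
  have h1 : ∑ W ∈ nullSets A, F W = ∑ W ∈ (nullSets A).filter (fun W => o ∈ W), G (W.erase o) := by
    rw [Finset.sum_filter]
    refine Finset.sum_congr rfl fun W hW => ?_
    by_cases h : o ∈ W
    · rw [if_pos h, hFG W hW h]
    · rw [if_neg h, hF W hW h]
  have h2 : ∑ W ∈ nullSets A, G W = ∑ W ∈ (nullSets A).filter (fun W => o ∉ W), G W := by
    rw [Finset.sum_filter]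
    refine Finset.sum_congr rfl fun W hW => ?_
    by_cases h : o ∈ W
    · rw [if_neg (not_not.2 h), hG W hW h]
    · rw [if_pos h]
  have himage : (nullSets A).filter (fun W => o ∈ W) = ((nullSets A).filter (fun W => o ∉ W)).image (insert o) := by
    ext W
    simp only [Finset.mem_filter, Finset.mem_image, mem_nullSets]
    constructor
    · rintro ⟨hWA, hoW⟩
      refine ⟨W.erase o, ⟨?_, Finset.notMem_erase o W⟩, Finset.insert_erase hoW⟩
      exact Finset.disjoint_of_subset_left (Finset.erase_subset o W) hWA
    · rintro ⟨W', ⟨hW'A, hoW'⟩, rfl⟩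
      refine ⟨?_, Finset.mem_insert_self o W'⟩
      rw [Finset.disjoint_insert_left]
      exact ⟨ho, hW'A⟩
  rw [h1, h2, himage, Finset.sum_image]
  · refine Finset.sum_congr rfl fun W' hW' => ?_
    rw [Finset.erase_insert (Finset.mem_filter.1 hW').2]
  · intro W₁ hW₁ W₂ hW₂ heq
    have h₁ := (Finset.mem_filter.1 hW₁).2
    have h₂ := (Finset.mem_filter.1 hW₂).2
    rw [← Finset.erase_insert h₁, ← Finset.erase_insert h₂, heq]

/-- **Corner (1,0): the observer glued to `x` is the observer `x` of `G − o`.**  `o ∉ A`, `x ≠ o`, `a ∈ A`, `b ≠ o`: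
`agood(w⁰[s(o,x)↦1], o; a) = agood(w⁰, x; a)`. [folklore] -/
theorem agood_wzero_glue_one (w : Sym2 (Fin n) → unitInterval) (A : Finset (Fin n)) (hA : A.Nonempty) (o x a b : Fin n)
    (ho : o ∉ A) (hxo : x ≠ o) (ha : a ∈ A) (hbo : b ≠ o) :
    (prodBernoulli (Function.update (pinW w {e : Sym2 (Fin n) | o ∈ e ∧ ¬ e.IsDiag} ∅) s(o, x) 1)).real (openConn o b) -
        (prodBernoulli (Function.update (pinW w {e : Sym2 (Fin n) | o ∈ e ∧ ¬ e.IsDiag} ∅) s(o, x) 1)).real (openConn a b) +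
        ∑ W ∈ nullSets A,
          (prodBernoulli (Function.update (pinW w {e : Sym2 (Fin n) | o ∈ e ∧ ¬ e.IsDiag} ∅) s(o, x) 1)).real (clusterIs o W) *
          A.inf' hA (fun a' => (prodBernoulli (Function.update (pinW w {e : Sym2 (Fin n) | o ∈ e ∧ ¬ e.IsDiag} ∅) s(o, x) 1)).real
            (openConnIn ((↑W : Set (Fin n))ᶜ) a' b)) =
      (prodBernoulli (pinW w {e : Sym2 (Fin n) | o ∈ e ∧ ¬ e.IsDiag} ∅)).real (openConn x b) -
        (prodBernoulli (pinW w {e : Sym2 (Fin n) | o ∈ e ∧ ¬ e.IsDiag} ∅)).real (openConn a b) +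
        ∑ W ∈ nullSets A, (prodBernoulli (pinW w {e : Sym2 (Fin n) | o ∈ e ∧ ¬ e.IsDiag} ∅)).real (clusterIs x W) *
          A.inf' hA (fun a' => (prodBernoulli (pinW w {e : Sym2 (Fin n) | o ∈ e ∧ ¬ e.IsDiag} ∅)).real
            (openConnIn ((↑W : Set (Fin n))ᶜ) a' b)) := by
  haveI : ∀ u : Sym2 (Fin n) → unitInterval, IsProbabilityMeasure (prodBernoulli u) := fun u => inferInstance
  have hox : o ≠ x := fun h => hxo h.symm
  have hao : a ≠ o := fun h => ho (h ▸ ha)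
  set w0 : Sym2 (Fin n) → unitInterval := pinW w {e : Sym2 (Fin n) | o ∈ e ∧ ¬ e.IsDiag} ∅ with hw0
  set μ0 := prodBernoulli w0 with hμ0
  set Z : Set (BondConfig (Fin n)) := {ω | ∀ u : Fin n, u ≠ o → s(o, u) ∉ ω} with hZ
  have hZ0 : μ0.real Zᶜ = 0 := real_compl_isolated_eq_zero w o
  have hw0e : w0 s(o, x) = 0 := pinW_star_mk w hxo
  have hup0 : Function.update w0 s(o, x) 0 = w0 := Function.update_eq_self_iff.2 hw0e.symm
  -- (i) `P(o ↔ b)`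
  have h1 : (prodBernoulli (Function.update w0 s(o, x) 1)).real (openConn o b) = μ0.real (openConn x b) := by
    rw [hw0, real_update_wzero_one w hxo, ← hw0, ← hμ0]
    refine measureReal_congr_of_null μ0 _ _ Z hZ0 ?_
    ext ω
    simp only [mem_inter_iff, mem_preimage]
    constructor
    · rintro ⟨h, hω⟩; exact ⟨(reachable_o_insert_iff_of_isolated hox hω hbo).1 h, hω⟩
    · rintro ⟨h, hω⟩; exact ⟨(reachable_o_insert_iff_of_isolated hox hω hbo).2 h, hω⟩
  -- (ii) `P(a ↔ b)`
  have h2 : (prodBernoulli (Function.update w0 s(o, x) 1)).real (openConn a b) = μ0.real (openConn a b) := by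
    rw [hw0, real_update_wzero_one w hxo, ← hw0, ← hμ0]
    refine measureReal_congr_of_null μ0 _ _ Z hZ0 ?_
    ext ω
    simp only [mem_inter_iff, mem_preimage]
    constructor
    · rintro ⟨h, hω⟩
      refine ⟨?_, hω⟩
      rcases (reachable_insert_iff_of_isolated hox hω hao hbo).1 h with h' | ⟨h', h''⟩
      · exact h'
      · exact h'.trans h''
    · rintro ⟨h, hω⟩; exact ⟨(reachable_insert_iff_of_isolated hox hω hao hbo).2 (Or.inl h), hω⟩
  -- (iii) the pocket sum
  have hinf : ∀ W ∈ nullSets A, o ∈ W →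
      A.inf' hA (fun a' => (prodBernoulli (Function.update w0 s(o, x) 1)).real (openConnIn ((↑W : Set (Fin n))ᶜ) a' b)) =
        A.inf' hA (fun a' => μ0.real (openConnIn ((↑(W.erase o) : Set (Fin n))ᶜ) a' b)) := by
    intro W _ hoW
    refine Finset.inf'_congr hA rfl fun a' ha' => ?_
    rw [real_update_eq_of_preimage_insert_eq w0 s(o, x) _ (preimage_insert_openConnIn_eq W o x a' b hoW) 1, hup0, hμ0, hw0]
    exact real_openConnIn_erase_wzero w o a' b (fun h => ho (h ▸ ha')) W
  have hcl : ∀ W ∈ nullSets A, o ∈ W →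
      (prodBernoulli (Function.update w0 s(o, x) 1)).real (clusterIs o W) = μ0.real (clusterIs x (W.erase o)) := by
    intro W _ hoW
    rw [hw0, real_update_wzero_one w hxo, ← hw0, ← hμ0]
    refine measureReal_congr_of_null μ0 _ _ Z hZ0 ?_
    ext ω
    simp only [mem_inter_iff, mem_preimage]
    constructor
    · rintro ⟨h, hω⟩
      refine ⟨?_, hω⟩
      rw [mem_clusterIs] at h ⊢
      ext z
      rw [Finset.coe_erase, mem_sdiff_singleton]
      constructor
      · intro hz
        have hzo : z ≠ o := by
          rintro rfl
          exact hxo (eq_of_reachable_of_isolated hω (show (openGraph ω).Reachable x z from hz).symm)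
        refine ⟨?_, hzo⟩
        rw [← h]
        exact (reachable_o_insert_iff_of_isolated hox hω hzo).2 hz
      · rintro ⟨hzW, hzo⟩
        have : z ∈ openCluster (insert s(o, x) ω) o := by rw [h]; exact hzW
        exact (reachable_o_insert_iff_of_isolated hox hω hzo).1 this
    · rintro ⟨h, hω⟩
      refine ⟨?_, hω⟩
      rw [mem_clusterIs] at h ⊢
      ext z
      by_cases hzo : z = o
      · subst hzo
        simp only [Finset.mem_coe, hoW, iff_true]
        exact mem_openCluster_self _ _
      · rw [show (z ∈ openCluster (insert s(o, x) ω) o) ↔ (openGraph (insert s(o, x) ω)).Reachable o z from Iff.rfl,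
          reachable_o_insert_iff_of_isolated hox hω hzo]
        rw [show (openGraph ω).Reachable x z ↔ z ∈ openCluster ω x from Iff.rfl, h, Finset.coe_erase, mem_sdiff_singleton]
        simp only [Finset.mem_coe, hzo, ne_eq, not_false_eq_true, and_true]
  have hcl0 : ∀ W ∈ nullSets A, o ∉ W → (prodBernoulli (Function.update w0 s(o, x) 1)).real (clusterIs o W) = 0 := by
    intro W _ hoW
    have : (clusterIs o W : Set (BondConfig (Fin n))) = ∅ := by
      ext ω
      simp only [mem_empty_iff_false, iff_false]
      intro hω
      rw [mem_clusterIs] at hω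
      have : o ∈ openCluster ω o := mem_openCluster_self ω o
      rw [hω, Finset.mem_coe] at this
      exact hoW this
    rw [this, measureReal_empty]
  have hclx : ∀ W ∈ nullSets A, o ∈ W → μ0.real (clusterIs x W) = 0 := by
    intro W _ hoW
    have h : μ0.real (clusterIs x W) = μ0.real (∅ : Set (BondConfig (Fin n))) := by
      refine measureReal_congr_of_null μ0 _ _ Z hZ0 ?_
      ext ω
      simp only [mem_inter_iff, mem_empty_iff_false, false_and, iff_false, not_and]
      intro hωW hω
      rw [mem_clusterIs] at hωW
      have : o ∈ openCluster ω x := by rw [hωW]; exact Finset.mem_coe.2 hoW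
      exact hxo (eq_of_reachable_of_isolated hω (show (openGraph ω).Reachable x o from this).symm)
    rw [h, measureReal_empty]
  have h3 : ∑ W ∈ nullSets A,
      (prodBernoulli (Function.update w0 s(o, x) 1)).real (clusterIs o W) *
        A.inf' hA (fun a' => (prodBernoulli (Function.update w0 s(o, x) 1)).real (openConnIn ((↑W : Set (Fin n))ᶜ) a' b)) =
      ∑ W ∈ nullSets A, μ0.real (clusterIs x W) * A.inf' hA (fun a' => μ0.real (openConnIn ((↑W : Set (Fin n))ᶜ) a' b)) := by
    refine sum_nullSets_reindex_erase A o ho _ _ (fun W hW hoW => by rw [hcl0 W hW hoW, zero_mul])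
      (fun W hW hoW => by rw [hclx W hW hoW, zero_mul]) (fun W hW hoW => ?_)
    rw [hcl W hW hoW, hinf W hW hoW]
  rw [h1, h2, h3]

/-- **Corner (1,1): the observer glued to `x` and `y` is the observer `x` of `(G − o) + xy`.**  `o ∉ A`, `x ≠ y` both `≠ o`, `a ∈ A`,
`b ≠ o`: `agood(w⁰[s(o,x)↦1][s(o,y)↦1], o; a) = agood(w⁰[s(x,y)↦1], x; a)`. [folklore] -/
theorem agood_wzero_glue_two (w : Sym2 (Fin n) → unitInterval) (A : Finset (Fin n)) (hA : A.Nonempty) (o x y a b : Fin n)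
    (ho : o ∉ A) (hxo : x ≠ o) (hyo : y ≠ o) (hxy : x ≠ y) (ha : a ∈ A) (hbo : b ≠ o) :
    (prodBernoulli (Function.update (Function.update (pinW w {e : Sym2 (Fin n) | o ∈ e ∧ ¬ e.IsDiag} ∅) s(o, x) 1) s(o, y) 1)).real
          (openConn o b) -
        (prodBernoulli (Function.update (Function.update (pinW w {e : Sym2 (Fin n) | o ∈ e ∧ ¬ e.IsDiag} ∅) s(o, x) 1) s(o, y) 1)).real
          (openConn a b) +
        ∑ W ∈ nullSets A,
          (prodBernoulli (Function.update (Function.update (pinW w {e : Sym2 (Fin n) | o ∈ e ∧ ¬ e.IsDiag} ∅) s(o, x) 1) s(o, y) 1)).real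
            (clusterIs o W) *
          A.inf' hA (fun a' => (prodBernoulli (Function.update (Function.update
            (pinW w {e : Sym2 (Fin n) | o ∈ e ∧ ¬ e.IsDiag} ∅) s(o, x) 1) s(o, y) 1)).real (openConnIn ((↑W : Set (Fin n))ᶜ) a' b)) =
      (prodBernoulli (Function.update (pinW w {e : Sym2 (Fin n) | o ∈ e ∧ ¬ e.IsDiag} ∅) s(x, y) 1)).real (openConn x b) -
        (prodBernoulli (Function.update (pinW w {e : Sym2 (Fin n) | o ∈ e ∧ ¬ e.IsDiag} ∅) s(x, y) 1)).real (openConn a b) +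
        ∑ W ∈ nullSets A, (prodBernoulli (Function.update (pinW w {e : Sym2 (Fin n) | o ∈ e ∧ ¬ e.IsDiag} ∅) s(x, y) 1)).real
            (clusterIs x W) *
          A.inf' hA (fun a' => (prodBernoulli (Function.update (pinW w {e : Sym2 (Fin n) | o ∈ e ∧ ¬ e.IsDiag} ∅) s(x, y) 1)).real
            (openConnIn ((↑W : Set (Fin n))ᶜ) a' b)) := by
  haveI : ∀ u : Sym2 (Fin n) → unitInterval, IsProbabilityMeasure (prodBernoulli u) := fun u => inferInstance
  have hox : o ≠ x := fun h => hxo h.symm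
  have hoy : o ≠ y := fun h => hyo h.symm
  have hao : a ≠ o := fun h => ho (h ▸ ha)
  set w0 : Sym2 (Fin n) → unitInterval := pinW w {e : Sym2 (Fin n) | o ∈ e ∧ ¬ e.IsDiag} ∅ with hw0
  set μ0 := prodBernoulli w0 with hμ0
  set Z : Set (BondConfig (Fin n)) := {ω | ∀ u : Fin n, u ≠ o → s(o, u) ∉ ω} with hZ
  have hZ0 : μ0.real Zᶜ = 0 := real_compl_isolated_eq_zero w o
  have hw0e : w0 s(o, x) = 0 := pinW_star_mk w hxo
  have hw0f : w0 s(o, y) = 0 := pinW_star_mk w hyo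
  have hfe : s(o, y) ≠ s(o, x) := fun h => hxy (Sym2.congr_right.1 h).symm
  -- insensitivity of `{· ↔ b off W}`, `o ∈ W`, to both glued pairs; and of `x ∈ W'` to `s(x,y)`
  have hins : ∀ (W : Finset (Fin n)) (a' : Fin n), o ∈ W →
      (prodBernoulli (Function.update (Function.update w0 s(o, x) 1) s(o, y) 1)).real (openConnIn ((↑W : Set (Fin n))ᶜ) a' b) =
        μ0.real (openConnIn ((↑W : Set (Fin n))ᶜ) a' b) := by
    intro W a' hoW
    rw [real_update_eq_of_preimage_insert_eq (Function.update w0 s(o, x) 1) s(o, y) _ (preimage_insert_openConnIn_eq W o y a' b hoW) 1]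
    have h0 : Function.update (Function.update w0 s(o, x) 1) s(o, y) 0 = Function.update w0 s(o, x) 1 := by
      rw [Function.update_eq_self_iff, Function.update_of_ne hfe]; exact hw0f.symm
    rw [h0, real_update_eq_of_preimage_insert_eq w0 s(o, x) _ (preimage_insert_openConnIn_eq W o x a' b hoW) 1,
      Function.update_eq_self_iff.2 hw0e.symm]
  have hinsg : ∀ (W : Finset (Fin n)) (a' : Fin n), x ∈ W →
      (prodBernoulli (Function.update w0 s(x, y) 1)).real (openConnIn ((↑W : Set (Fin n))ᶜ) a' b) =
        μ0.real (openConnIn ((↑W : Set (Fin n))ᶜ) a' b) := by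
    intro W a' hxW
    rw [real_update_eq_of_preimage_insert_eq w0 s(x, y) _ (preimage_insert_openConnIn_eq W x y a' b hxW) 1,
      ← real_update_eq_of_preimage_insert_eq w0 s(x, y) _ (preimage_insert_openConnIn_eq W x y a' b hxW) (w0 s(x, y)),
      Function.update_eq_self]
  -- (i) `P(o ↔ b)`
  have h1 : (prodBernoulli (Function.update (Function.update w0 s(o, x) 1) s(o, y) 1)).real (openConn o b) =
      (prodBernoulli (Function.update w0 s(x, y) 1)).real (openConn x b) := by
    have h := KNConjOne.real_reach_update_wzero_one_one w {b} o x y (by rw [Finset.mem_singleton]; exact hbo.symm) hxo hyo hxy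
    have e1 : {ω : BondConfig (Fin n) | ∃ t ∈ ({b} : Finset (Fin n)), ω ∈ openConn o t} = openConn o b := by
      ext ω; simp only [Finset.mem_singleton, exists_eq_left, mem_setOf_eq]
    have e2 : {ω : BondConfig (Fin n) | ∃ t ∈ ({b} : Finset (Fin n)), ω ∈ openConn x t} = openConn x b := by
      ext ω; simp only [Finset.mem_singleton, exists_eq_left, mem_setOf_eq]
    rw [e1, e2] at h
    rw [hw0]; exact h
  -- (ii) `P(a ↔ b)`
  have h2 : (prodBernoulli (Function.update (Function.update w0 s(o, x) 1) s(o, y) 1)).real (openConn a b) =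
      (prodBernoulli (Function.update w0 s(x, y) 1)).real (openConn a b) := by
    rw [hw0, real_update_wzero_one_one w hxo hyo hxy, ← hw0, ← hμ0, tieLiftTwo_real_update_one w0 s(x, y)]
    refine measureReal_congr_of_null μ0 _ _ Z hZ0 ?_
    ext ω
    simp only [mem_inter_iff, mem_setOf_eq, mem_preimage]
    constructor
    · rintro ⟨h, hω⟩
      refine ⟨?_, hω⟩
      show (openGraph (insert s(x, y) ω)).Reachable a b
      rw [reachable_insert_pair_iff ω hxy a b]
      exact (reachable_insert₂_iff_of_isolated hox hoy hω hao hbo).1 h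
    · rintro ⟨h, hω⟩
      refine ⟨?_, hω⟩
      show (openGraph (insert s(o, y) (insert s(o, x) ω))).Reachable a b
      rw [reachable_insert₂_iff_of_isolated hox hoy hω hao hbo]
      exact (reachable_insert_pair_iff ω hxy a b).1 h
  -- (iii) the pocket sum
  have hcl : ∀ W ∈ nullSets A, o ∈ W →
      (prodBernoulli (Function.update (Function.update w0 s(o, x) 1) s(o, y) 1)).real (clusterIs o W) =
        (prodBernoulli (Function.update w0 s(x, y) 1)).real (clusterIs x (W.erase o)) := by
    intro W _ hoW
    rw [hw0, real_update_wzero_one_one w hxo hyo hxy, ← hw0, ← hμ0, tieLiftTwo_real_update_one w0 s(x, y)]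
    refine measureReal_congr_of_null μ0 _ _ Z hZ0 ?_
    -- on `Z`: `C''(o) = {o} ∪ C(x) ∪ C(y)` and `C_{+xy}(x) = C(x) ∪ C(y)`
    have key : ∀ ω : BondConfig (Fin n), ω ∈ Z → ∀ z : Fin n, z ≠ o →
        ((openGraph (insert s(o, y) (insert s(o, x) ω))).Reachable o z ↔ (openGraph (insert s(x, y) ω)).Reachable x z) := by
      intro ω hω z hzo
      rw [reachable_o_insert₂_iff_of_isolated hox hoy hω hzo, reachable_insert_left_iff ω hxy z]
    have hxno : ∀ ω : BondConfig (Fin n), ω ∈ Z → ¬ (openGraph (insert s(x, y) ω)).Reachable x o := by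
      intro ω hω h
      rw [reachable_insert_left_iff ω hxy o] at h
      rcases h with h | h
      · exact hxo (eq_of_reachable_of_isolated hω h.symm)
      · exact hyo (eq_of_reachable_of_isolated hω h.symm)
    ext ω
    simp only [mem_inter_iff, mem_setOf_eq, mem_preimage]
    constructor
    · rintro ⟨h, hω⟩
      refine ⟨?_, hω⟩
      rw [mem_clusterIs] at h ⊢
      ext z
      rw [Finset.coe_erase, mem_sdiff_singleton]
      constructor
      · intro hz
        have hzo : z ≠ o := by rintro rfl; exact hxno ω hω hz
        refine ⟨?_, hzo⟩
        rw [← h]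
        exact (key ω hω z hzo).2 hz
      · rintro ⟨hzW, hzo⟩
        have : z ∈ openCluster (insert s(o, y) (insert s(o, x) ω)) o := by rw [h]; exact hzW
        exact (key ω hω z hzo).1 this
    · rintro ⟨h, hω⟩
      refine ⟨?_, hω⟩
      rw [mem_clusterIs] at h ⊢
      ext z
      by_cases hzo : z = o
      · subst hzo
        simp only [Finset.mem_coe, hoW, iff_true]
        exact mem_openCluster_self _ _
      · rw [show (z ∈ openCluster (insert s(o, y) (insert s(o, x) ω)) o) ↔
            (openGraph (insert s(o, y) (insert s(o, x) ω))).Reachable o z from Iff.rfl, key ω hω z hzo,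
          show (openGraph (insert s(x, y) ω)).Reachable x z ↔ z ∈ openCluster (insert s(x, y) ω) x from Iff.rfl, h,
          Finset.coe_erase, mem_sdiff_singleton]
        simp only [Finset.mem_coe, hzo, ne_eq, not_false_eq_true, and_true]
  have hcl0 : ∀ W ∈ nullSets A, o ∉ W →
      (prodBernoulli (Function.update (Function.update w0 s(o, x) 1) s(o, y) 1)).real (clusterIs o W) = 0 := by
    intro W _ hoW
    have : (clusterIs o W : Set (BondConfig (Fin n))) = ∅ := by
      ext ω
      simp only [mem_empty_iff_false, iff_false]
      intro hω
      rw [mem_clusterIs] at hω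
      have : o ∈ openCluster ω o := mem_openCluster_self ω o
      rw [hω, Finset.mem_coe] at this
      exact hoW this
    rw [this, measureReal_empty]
  have hclx : ∀ W ∈ nullSets A, o ∈ W → (prodBernoulli (Function.update w0 s(x, y) 1)).real (clusterIs x W) = 0 := by
    intro W _ hoW
    rw [tieLiftTwo_real_update_one w0 s(x, y), ← hμ0]
    have h : μ0.real ((fun ω : BondConfig (Fin n) => insert s(x, y) ω) ⁻¹' (clusterIs x W : Set (BondConfig (Fin n)))) =
        μ0.real (∅ : Set (BondConfig (Fin n))) := by
      refine measureReal_congr_of_null μ0 _ _ Z hZ0 ?_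
      ext ω
      simp only [mem_inter_iff, mem_empty_iff_false, false_and, iff_false, not_and, mem_preimage]
      intro hωW hω
      rw [mem_clusterIs] at hωW
      have : o ∈ openCluster (insert s(x, y) ω) x := by rw [hωW]; exact Finset.mem_coe.2 hoW
      have h' : (openGraph (insert s(x, y) ω)).Reachable x o := this
      rw [reachable_insert_left_iff ω hxy o] at h'
      rcases h' with h' | h'
      · exact hxo (eq_of_reachable_of_isolated hω h'.symm)
      · exact hyo (eq_of_reachable_of_isolated hω h'.symm)
    rw [h, measureReal_empty]
  -- terms with `x ∉ W'` vanish on the right; match the minima on the others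
  have hclx' : ∀ W : Finset (Fin n), x ∉ W → (prodBernoulli (Function.update w0 s(x, y) 1)).real (clusterIs x W) = 0 := by
    intro W hxW
    have : (clusterIs x W : Set (BondConfig (Fin n))) = ∅ := by
      ext ω
      simp only [mem_empty_iff_false, iff_false]
      intro hω
      rw [mem_clusterIs] at hω
      have : x ∈ openCluster ω x := mem_openCluster_self ω x
      rw [hω, Finset.mem_coe] at this
      exact hxW this
    rw [this, measureReal_empty]
  have h3 : ∑ W ∈ nullSets A,
      (prodBernoulli (Function.update (Function.update w0 s(o, x) 1) s(o, y) 1)).real (clusterIs o W) *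
        A.inf' hA (fun a' => (prodBernoulli (Function.update (Function.update w0 s(o, x) 1) s(o, y) 1)).real
          (openConnIn ((↑W : Set (Fin n))ᶜ) a' b)) =
      ∑ W ∈ nullSets A, (prodBernoulli (Function.update w0 s(x, y) 1)).real (clusterIs x W) *
        A.inf' hA (fun a' => (prodBernoulli (Function.update w0 s(x, y) 1)).real (openConnIn ((↑W : Set (Fin n))ᶜ) a' b)) := by
    refine sum_nullSets_reindex_erase A o ho _ _ (fun W hW hoW => by rw [hcl0 W hW hoW, zero_mul])
      (fun W hW hoW => by rw [hclx W hW hoW, zero_mul]) (fun W hW hoW => ?_)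
    rw [hcl W hW hoW]
    by_cases hxW : x ∈ W.erase o
    · congr 1
      refine Finset.inf'_congr hA rfl fun a' ha' => ?_
      rw [hins W a' hoW, hinsg (W.erase o) a' hxW, hμ0, hw0]
      exact real_openConnIn_erase_wzero w o a' b (fun h => ho (h ▸ ha')) W
    · rw [hclx' (W.erase o) hxW, zero_mul, zero_mul]
  rw [h1, h2, h3]

end KNGoodSeries

end Summit.CriticalPhenomena.PercolationContinuityZ3.Theorems

end
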